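import Summits.Langlands.Langlands.Theorems.IrreducibilityBySelfDualityPairLBoundaryJSCornerLocalControlAsm
import Summits.Langlands.Langlands.Theorems.IrreducibilityBySelfDualityPairLBoundaryJSGapArchFactorData
import Summits.Langlands.Langlands.Theorems.IrreducibilityBySelfDualityPairLBoundaryJSGapUnitBoxProductForm
import Summits.Langlands.Langlands.Theorems.IrreducibilityBySelfDualityPairLBoundaryJSGapLocalSingleDatumOfProductForm

/-!
# Crux `PairLBoundaryJS` (stmt-Langlands-13622), line `Sketch` — the gap local control (G-LC) assembled
# from the archimedean `GL_n × GL_m` data (G-AFD) and the single-datum realisation (G-LSD)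

Summit `Langlands`, sub-problem `Langlands`, helper file under `Theorems/` supporting the crux `PairLBoundaryJS`
(Arthur–Clozel (1989), Ch. 3, (2.2)), line `Sketch`, skeleton v19 (lead c6), registered stub
`stub_gap_local_control` (G-LC) of the GAP ROAD: the `GL_n × GL_m` (`0 < m < n`) version of
`CornerLocalControlAsm.stub_corner_local_control`. `gap_local_control_of_parts` is the implication
`(G-AFD) → (G-LSD) → (G-LC)`: the gap LOCAL Rankin–Selberg theory in translate form AT A PRESCRIBED POINT `s₀`
follows from the archimedean `GL_n × GL_m` data at `s₀` with their reciprocal entire factor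
(`GapArchFactorData.stub_gap_arch_factor_data`, on the named fact
`JacquetShalika1990_archRankinSelbergGap_entireRatio`: Jacquet (2009), Thm. 2.1/2.6, Prop. 12.5; Cogdell (2004),
Thm. 3.5, §4.2) and the realisation of ONE archimedean datum inside the translated gap box integral
(`GapLocalSingleDatum.stub_gap_local_single_datum`). Assembly as the corner: the torus of Whittaker shifts off `S₀`
in rank `n` (`WhittakerShiftTorusOffIntegral`) is `T`, and `τ := T ∘ Fin.castLE` (its first `m` entries); the
rank-`m` facts for `diag τ` are read off the rank-`n` ones entry by entry (`localComponent_glDiagonal`,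
`GLn.toMixed_glDiagonal`, `glDiagonal_eq_one_iff`); the archimedean components
(`exists_archComponent_decomposition`); initial pure tensors with non-zero translated transferred Whittaker
functionals (`InitialVectorTranslateNeZero`, for `π` with `diag T`, for `σ` with `diag τ`); the data
`(e_i, e'_i, Λ, h, x₀)` of G-AFD at `s₀` for the image Haar measures (`isHaarMeasure_map_archTorusOfIdele`,
`isHaarMeasure_map_kinfOfMaximalCompact`); each datum realised by G-LSD with `κ_i > 0`; `c_i := κ_i⁻¹`, one level
`𝔫₀ := ∏_i 𝔫_i` (`principalCongruenceLevel_mono`, `exists_dvd_of_dvd_prod`), `x₁ := x₀`, and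
`Λ · Σ_i c_i Box_i = Λ · Σ_i Ψ_i = h`.

References: Jacquet–Piatetski-Shapiro–Shalika, Amer. J. Math. 105 (1983), Thm. 2.7
[JacquetPiatetskiShapiroShalika1983]; Cogdell, *Analytic theory of L-functions for GL_n* (2004), §3.2, §4.1, §4.2
[CogdellAnalyticTheory2004]; Jacquet, Contemp. Math. 489 (2009), Thm. 2.1, Thm. 2.6 (i) [JacquetArchimedeanRS2009].
-/

noncomputable section

-- `Summit.Langlands.Langlands.…` (summit = sub-problem name, D-0017 layout) trips `dupNamespace`
set_option linter.dupNamespace false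

open scoped MatrixGroups Topology Pointwise ENNReal NNReal ComplexConjugate InnerProductSpace ContDiff
-- the place subtypes indexing `mixedSpace K` are `Fintype` classically (`NormedCommRing (mixedSpace K)`)
open scoped Classical Matrix.Norms.Operator
open NumberField IsDedekindDomain MeasureTheory Measure Matrix Set Filter WithZero
open NumberField.mixedEmbedding
open Literature.NumberTheory.Automorphic AdelicGroupData
open Literature.NumberTheory.GaloisRepresentations (ideleGroup HeckeCharacter)
open Literature.MeasureTheory.Group
open ValuativeRel

-- the automorphic quotient carries the tree's Borel σ-algebra, not Mathlib's quotient σ-algebra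
attribute [-instance] Quotient.instMeasurableSpace QuotientGroup.measurableSpace

-- the house local instances, exactly as in `RankinSelbergUnfoldingIdentity`
attribute [local instance] adelicBorel borelSpace_adelic locallyCompactSpace_adelic secondCountableTopology_gl_adelic
  glAdeleBorel borelSpace_glAdele borelSpace_ideleGroup secondCountableTopology_ideleGroup

-- Mathlib idiom: the commutator Lie ring on matrices, to mention `(archGroupGL n K).lie`
attribute [local instance 100] LieRing.ofAssociativeRing

-- Borel structures on the archimedean unit groups (house pattern of `ArchRankinSelbergPairBridge`)
attribute [local instance] Literature.MeasureTheory.Group.Units.borelSpace_of_isOpenEmbedding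
  Literature.MeasureTheory.Group.Units.secondCountableTopology
  Literature.MeasureTheory.Group.Units.locallyCompactSpace

namespace Summit.Langlands.Langlands.Theorems.GapLocalControlAsm

open CornerLocalControlAsm (glDiagonal_injective glDiagonal_eq_one_iff localComponent_glDiagonal)

/-! ### The assembly -/

set_option maxHeartbeats 1600000 in
/-- **The gap local control assembled from its parts**: `(G-AFD) → (G-LSD) → (G-LC)`, where G-LC is the
statement of the registered stub `stub_gap_local_control` (the gap LOCAL Rankin–Selberg theory in translate form at
a prescribed point `s₀`, granted the archimedean gap fact), G-AFD that of
`GapArchFactorData.stub_gap_arch_factor_data` and G-LSD that of `GapLocalSingleDatum.stub_gap_local_single_datum`.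
See the module docstring for the assembly. [cite: JacquetPiatetskiShapiroShalika1983, Thm. 2.7]
[cite: CogdellAnalyticTheory2004, §3.2, §4.1 and §4.2] [cite: JacquetArchimedeanRS2009, Thm. 2.6 (i) (p. 9)] -/
theorem gap_local_control_of_parts :
    (∀ {n m : ℕ} {K : Type} [Field K] [NumberField K],
      JacquetShalika1990_archRankinSelbergGap_entireRatio n m K →
    ∀ (hmn : m < n) (hcpt : isCompact_glFiniteIntegralLevel n K) (hcpt' : isCompact_glFiniteIntegralLevel m K)
      (E : Type) [NormedAddCommGroup E] [InnerProductSpace ℂ E] [CompleteSpace E]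
      (τ : ContRepresentation ℂ (AutomorphyDatum.gl n K hcpt).arch.carrier E) (hτ : τ.IsStronglyContinuous)
      (_ : τ.IsUnitary) (_ : τ.IsTopIrreducible)
      (ℓ : archGardingSpace hcpt τ →ₗ[ℂ] ℂ) (_ : IsArchContWhittakerFunctional hcpt τ hτ ℓ) (_ : ℓ ≠ 0)
      (E' : Type) [NormedAddCommGroup E'] [InnerProductSpace ℂ E'] [CompleteSpace E']
      (τ' : ContRepresentation ℂ (AutomorphyDatum.gl m K hcpt').arch.carrier E') (hτ' : τ'.IsStronglyContinuous)
      (_ : τ'.IsUnitary) (_ : τ'.IsTopIrreducible)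
      (ℓ' : archGardingSpace hcpt' τ' →ₗ[ℂ] ℂ) (_ : IsArchContWhittakerFunctional hcpt' τ' hτ' ℓ') (_ : ℓ' ≠ 0)
      [MeasurableSpace (GL (Fin m) (mixedSpace K))] [BorelSpace (GL (Fin m) (mixedSpace K))]
      [MeasurableSpace ((mixedSpace K)ˣ)] [BorelSpace ((mixedSpace K)ˣ)]
      (μA : Measure (Fin m → (mixedSpace K)ˣ)) (_ : IsHaarMeasure μA)
      (μK : Measure ↥(Kinf m K)) (_ : IsHaarMeasure μK) (s₀ : ℂ),
      ∃ (k : ℕ) (e : Fin k → archGardingSpace hcpt τ) (e' : Fin k → archGardingSpace hcpt' τ')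
        (_ : ∀ i, FiniteDimensional ℂ (Submodule.span ℂ (Set.range
          fun κ : (AutomorphyDatum.gl n K hcpt).arch.maximalCompact =>
            τ (toArch hcpt (κ : GL (Fin n) (mixedSpace K))) (e i : E))))
        (_ : ∀ i, FiniteDimensional ℂ (Submodule.span ℂ (Set.range
          fun κ : (AutomorphyDatum.gl m K hcpt').arch.maximalCompact =>
            τ' (toArch hcpt' (κ : GL (Fin m) (mixedSpace K))) (e' i : E'))))
        (Λ h : ℂ → ℂ) (x₀ : ℝ), Differentiable ℂ Λ ∧ Differentiable ℂ h ∧ h s₀ ≠ 0 ∧ ∀ s : ℂ, x₀ < s.re →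
          Λ s * ∑ i, archGapPairIntegralCplx hmn.le hcpt hcpt' τ hτ τ' hτ' ℓ ℓ' (e i) (e' i) μA μK s = h s) →
    (∀ {n m : ℕ} {K : Type} [Field K] [NumberField K]
      {μ : Measure (gl n K).automorphicQuotient} [(gl n K).IsAutomorphicMeasure μ]
      {μ' : Measure (gl m K).automorphicQuotient} [(gl m K).IsAutomorphicMeasure μ']
      [MeasurableSpace (AdeleRing (𝓞 K) K)] [BorelSpace (AdeleRing (𝓞 K) K)] (_hm : 0 < m) (hmn : m < n)
      (hcpt : isCompact_glFiniteIntegralLevel n K) (hcpt' : isCompact_glFiniteIntegralLevel m K)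
      (P : CuspidalAutomorphicRepGL n K μ) (Q : CuspidalAutomorphicRepGL m K μ')
      (νA : Measure (Fin m → ideleGroup K)) [IsHaarMeasure νA]
      (νK : Measure ↥(maximalCompactAdelic m K)) [IsHaarMeasure νK]
      (ν₀ : Measure ↥(adelicUnipotent n K)) [IsHaarMeasure ν₀]
      (ν₀' : Measure ↥(adelicUnipotent m K)) [IsHaarMeasure ν₀']
      {E : Type} [NormedAddCommGroup E] [InnerProductSpace ℂ E] [CompleteSpace E]
      {τP : ContRepresentation ℂ (archGroupGL n K).carrier E} (hτPc : τP.IsStronglyContinuous)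
      {E' : Type} [NormedAddCommGroup E'] [InnerProductSpace ℂ E'] [CompleteSpace E']
      {τQ : ContRepresentation ℂ (archGroupGL m K).carrier E'} (hτQc : τQ.IsStronglyContinuous)
      (S₀ : Finset (HeightOneSpectrum (𝓞 K))) (τ : Fin m → ideleGroup K) (T : Fin n → ideleGroup K)
      (_ : GLn.toMixed m K (glDiagonal m (AdeleRing (𝓞 K) K) τ) = 1)
      (_ : ∀ v ∈ S₀, localComponent v (glDiagonal m (AdeleRing (𝓞 K) K) τ) = 1)
      (_ : GLn.toMixed n K (glDiagonal n (AdeleRing (𝓞 K) K) T) = 1)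
      (_ : ∀ v ∈ S₀, localComponent v (glDiagonal n (AdeleRing (𝓞 K) K) T) = 1)
      {𝔫P 𝔫Q : Ideal (𝓞 K)} (_ : 𝔫P ≠ 0) (_ : 𝔫Q ≠ 0)
      (_ : ∀ w ∉ S₀, ¬ w.asIdeal ∣ 𝔫P * 𝔫Q)
      (S₁ : multiplicityModule hcpt τP P.1)
      (_ : (S₁ : E →L[ℂ] (gl n K).L2 μ) ∈ archIntertwinersLevel hcpt τP P.1 (finitePrincipalCongruenceLevel n K 𝔫P))
      (S₁' : multiplicityModule hcpt' τQ Q.1)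
      (_ : (S₁' : E' →L[ℂ] (gl m K).L2 μ') ∈ archIntertwinersLevel hcpt' τQ Q.1 (finitePrincipalCongruenceLevel m K 𝔫Q))
      (e : archGardingSpace hcpt τP) (e' : archGardingSpace hcpt' τQ)
      (_ : FiniteDimensional ℂ (Submodule.span ℂ (Set.range
        fun κ : ↥(Kinf n K) => τP (toArch hcpt κ.1) e.1)))
      (_ : FiniteDimensional ℂ (Submodule.span ℂ (Set.range
        fun κ : ↥(Kinf m K) => τQ (toArch hcpt' κ.1) e'.1)))
      [MeasurableSpace (GL (Fin m) (mixedSpace K))] [BorelSpace (GL (Fin m) (mixedSpace K))],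
    ∃ (𝔫 : Ideal (𝓞 K)) (_ : 𝔫 ≠ 0) (_ : ∀ w ∉ S₀, ¬ w.asIdeal ∣ 𝔫)
      (Φ : (gl n K).automorphicQuotient → ℂ) (Φ' : (gl m K).automorphicQuotient → ℂ)
      (sv : P.1.toSubmodule) (sv' : Q.1.toSubmodule) (_ : Continuous Φ) (_ : Continuous Φ')
      (_ : ((sv : (gl n K).L2 μ) : _ → ℂ) =ᵐ[μ] Φ)
      (_ : ((sv' : (gl m K).L2 μ') : _ → ℂ) =ᵐ[μ'] Φ')
      (_ : IsCuspFormGL n K hcpt (invQuot (gl n K) Φ))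
      (_ : IsCuspFormGL m K hcpt' (invQuot (gl m K) Φ'))
      (_ : ∀ u ∈ principalCongruenceLevel n K 𝔫, ∀ y, invQuot (gl n K) Φ (y * u :) = invQuot (gl n K) Φ y)
      (_ : ∀ u ∈ principalCongruenceLevel m K 𝔫, ∀ y, invQuot (gl m K) Φ' (y * u :) = invQuot (gl m K) Φ' y)
      (κ : ℝ), 0 < κ ∧
      ∀ s,
        ∫ p in unitBox {v | v ∉ (↑S₀ : Set _)} ×ˢ univ,
          torusPairIntegrandC m K
            (fun g => whittakerCoeff ν₀ (unipotentTateDomain n K) (adeleAddChar K) (invQuot (gl n K) Φ)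
              (glDiagonal n (AdeleRing (𝓞 K) K) T * glCorner (AdeleRing (𝓞 K) K) hmn.le g))
            (fun g => star (whittakerCoeff ν₀' (unipotentTateDomain m K) (adeleAddChar K) (invQuot (gl m K) Φ')
              (glDiagonal m (AdeleRing (𝓞 K) K) τ * g)))
            (fun _ => 1) s p ∂(νA.prod νK) =
        (κ : ℂ) * archGapPairIntegralCplx hmn.le hcpt hcpt' τP hτPc τQ hτQc
          (transferMap (whittakerFunctional ν₀ (continuous_adeleAddChar K) (ContRepresentation.Equiv.refl P.1.toContRep)) hτPc
            (finComponentRep hcpt τP P.1 (GLn.sndHom n K (glDiagonal n (AdeleRing (𝓞 K) K) T)) S₁))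
          (transferMap (whittakerFunctional ν₀' (continuous_adeleAddChar K) (ContRepresentation.Equiv.refl Q.1.toContRep)) hτQc
            (finComponentRep hcpt' τQ Q.1 (GLn.sndHom m K (glDiagonal m (AdeleRing (𝓞 K) K) τ)) S₁')) e e'
          ((νA.restrict (unitBox univ)).map (archTorusOfIdele m K)) (νK.map (kinfOfMaximalCompact m K)) s) →
    (∀ (N M : ℕ) (K : Type) [Field K] [NumberField K], JacquetShalika1990_archRankinSelbergGap_entireRatio N M K) →
    ∀ {n m : ℕ} {K : Type} [Field K] [NumberField K]
      {μ : Measure (AdelicGroupData.gl n K).automorphicQuotient}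
      [(AdelicGroupData.gl n K).IsAutomorphicMeasure μ]
      {μ' : Measure (AdelicGroupData.gl m K).automorphicQuotient} [(AdelicGroupData.gl m K).IsAutomorphicMeasure μ']
      [MeasurableSpace (AdeleRing (𝓞 K) K)] [BorelSpace (AdeleRing (𝓞 K) K)] (_hm : 0 < m) (hmn : m < n)
      (νA : Measure (Fin m → ideleGroup K)) [IsHaarMeasure νA]
      (νK : Measure ↥(maximalCompactAdelic m K)) [IsHaarMeasure νK]
      (ν₀ : Measure ↥(adelicUnipotent n K)) [IsHaarMeasure ν₀]
      (ν₀' : Measure ↥(adelicUnipotent m K)) [IsHaarMeasure ν₀']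
      (P : CuspidalAutomorphicRepGL n K μ) (Q : CuspidalAutomorphicRepGL m K μ')
      (S₀ : Finset (HeightOneSpectrum (𝓞 K))), (∀ v ∉ S₀, IsUnramifiedAt P.1 v ∧ IsUnramifiedAt Q.1 v) →
      ∀ (s₀ : ℂ),
      ∃ (τ : Fin m → ideleGroup K) (T : Fin n → ideleGroup K),
      (∀ i : Fin m, T (Fin.castLE hmn.le i) = τ i) ∧
      GLn.toMixed n K (glDiagonal n (AdeleRing (𝓞 K) K) T) = 1 ∧
      (∀ v ∉ S₀, ∃ (d : Fin n → (v.adicCompletion K)ˣ) (a : (v.adicCompletion K)ˣ),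
        localComponent v (glDiagonal n (AdeleRing (𝓞 K) K) T) =
          diagonalGL (Fin n) (v.adicCompletion K) d ∧
        (∀ i j : Fin n, (i : ℕ) + 1 = j →
          (d i : v.adicCompletion K) * ((d j)⁻¹ : (v.adicCompletion K)ˣ) = a) ∧
        (∀ c ∈ 𝒪[v.adicCompletion K], (adeleAddChar K).adicComponent v (a * c) = 1) ∧
        ∀ ϖ : v.adicCompletion K, Valued.v ϖ = WithZero.exp (-1 : ℤ) →
          ∃ c ∈ 𝒪[v.adicCompletion K], (adeleAddChar K).adicComponent v (a * (ϖ⁻¹ * c)) ≠ 1) ∧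
      (∀ v ∉ S₀, ∃ (d : Fin m → (v.adicCompletion K)ˣ) (a : (v.adicCompletion K)ˣ),
        localComponent v (glDiagonal m (AdeleRing (𝓞 K) K) τ) =
          diagonalGL (Fin m) (v.adicCompletion K) d ∧
        (∀ i j : Fin m, (i : ℕ) + 1 = j →
          (d i : v.adicCompletion K) * ((d j)⁻¹ : (v.adicCompletion K)ˣ) = a) ∧
        (∀ c ∈ 𝒪[v.adicCompletion K], (adeleAddChar K).adicComponent v (a * c) = 1) ∧
        ∀ ϖ : v.adicCompletion K, Valued.v ϖ = WithZero.exp (-1 : ℤ) →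
          ∃ c ∈ 𝒪[v.adicCompletion K], (adeleAddChar K).adicComponent v (a * (ϖ⁻¹ * c)) ≠ 1) ∧
      ∃ (k : ℕ) (c : Fin k → ℂ)
        (Φ : Fin k → (AdelicGroupData.gl n K).automorphicQuotient → ℂ)
        (Φ' : Fin k → (AdelicGroupData.gl m K).automorphicQuotient → ℂ)
        (sv : Fin k → P.1.toSubmodule) (sv' : Fin k → Q.1.toSubmodule) (𝔫₀ : Ideal (𝓞 K)),
      𝔫₀ ≠ 0 ∧ (∀ w : HeightOneSpectrum (𝓞 K), w.asIdeal ∣ 𝔫₀ → w ∈ S₀) ∧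
      (∀ i, Continuous (Φ i)) ∧ (∀ i, Continuous (Φ' i)) ∧
      (∀ i, (((sv i : (AdelicGroupData.gl n K).L2 μ) : (AdelicGroupData.gl n K).automorphicQuotient → ℂ)
        =ᵐ[μ] Φ i)) ∧
      (∀ i, (((sv' i : (AdelicGroupData.gl m K).L2 μ') : (AdelicGroupData.gl m K).automorphicQuotient → ℂ)
        =ᵐ[μ'] Φ' i)) ∧
      (∀ i, IsCuspFormGL n K (isCompact_glFiniteIntegralLevel_holds n K)
        (invQuot (AdelicGroupData.gl n K) (Φ i))) ∧
      (∀ i, IsCuspFormGL m K (isCompact_glFiniteIntegralLevel_holds m K) (invQuot (AdelicGroupData.gl m K) (Φ' i))) ∧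
      (∀ i, ∀ u ∈ principalCongruenceLevel n K 𝔫₀, ∀ y : GL (Fin n) (AdeleRing (𝓞 K) K),
        invQuot (AdelicGroupData.gl n K) (Φ i) (y * u) = invQuot (AdelicGroupData.gl n K) (Φ i) y) ∧
      (∀ i, ∀ u ∈ principalCongruenceLevel m K 𝔫₀, ∀ y : GL (Fin m) (AdeleRing (𝓞 K) K),
        invQuot (AdelicGroupData.gl m K) (Φ' i) (y * u) = invQuot (AdelicGroupData.gl m K) (Φ' i) y) ∧
      ∃ (Λ h : ℂ → ℂ) (x₁ : ℝ), Differentiable ℂ Λ ∧ Differentiable ℂ h ∧ h s₀ ≠ 0 ∧ ∀ s : ℂ, x₁ < s.re →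
        Λ s * ∑ i, c i * ∫ p in unitBox {v | v ∉ (↑S₀ : Set (HeightOneSpectrum (𝓞 K)))} ×ˢ Set.univ,
          torusPairIntegrandC m K
            (fun g => whittakerCoeff ν₀ (unipotentTateDomain n K) (adeleAddChar K)
              (invQuot (AdelicGroupData.gl n K) (Φ i))
              (glDiagonal n (AdeleRing (𝓞 K) K) T * glCorner (AdeleRing (𝓞 K) K) hmn.le g))
            (fun g => star (whittakerCoeff ν₀' (unipotentTateDomain m K) (adeleAddChar K)
              (invQuot (AdelicGroupData.gl m K) (Φ' i)) (glDiagonal m (AdeleRing (𝓞 K) K) τ * g)))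
            (fun _ => (1 : ℝ)) s p ∂(νA.prod νK) = h s := by
  intro hAFD hLSD hJ n m K _ _ μ _ μ' _ _ _ hm hmn νA _ νK _ ν₀ _ ν₀' _ P Q S₀ hunr s₀
  have hcpt : isCompact_glFiniteIntegralLevel n K := isCompact_glFiniteIntegralLevel_holds n K
  have hcpt' : isCompact_glFiniteIntegralLevel m K := isCompact_glFiniteIntegralLevel_holds m K
  -- (1) the torus of Whittaker shifts off `S₀` in rank `n` is `T`; `τ` is its first `m` entries
  obtain ⟨T, -, -, -, -, hDinf, hDS₀, hoff⟩ :=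
    WhittakerShiftTorusOffIntegral.stub_whittakerShiftTorus_off_integral n K S₀
  set τ : Fin m → ideleGroup K := fun i => T (Fin.castLE hmn.le i)
  -- the rank-`m` facts for `D' = diag τ`, read off the rank-`n` facts for `D = diag T`
  have hD'inf : GLn.toMixed m K (glDiagonal m (AdeleRing (𝓞 K) K) τ) = 1 := by
    rw [GLn.toMixed_glDiagonal, glDiagonal_eq_one_iff] at hDinf ⊢
    exact fun i => hDinf (Fin.castLE hmn.le i)
  have hD'S₀ : ∀ v ∈ S₀, localComponent v (glDiagonal m (AdeleRing (𝓞 K) K) τ) = 1 := by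
    intro v hv
    have h := hDS₀ v hv
    rw [localComponent_glDiagonal, glDiagonal_eq_one_iff] at h ⊢
    exact fun i => h (Fin.castLE hmn.le i)
  have hoff' : ∀ v ∉ S₀, ∃ (d : Fin m → (v.adicCompletion K)ˣ) (a : (v.adicCompletion K)ˣ),
      localComponent v (glDiagonal m (AdeleRing (𝓞 K) K) τ) = diagonalGL (Fin m) (v.adicCompletion K) d ∧
      (∀ i j : Fin m, (i : ℕ) + 1 = j →
        (d i : v.adicCompletion K) * ((d j)⁻¹ : (v.adicCompletion K)ˣ) = a) ∧
      (∀ c ∈ 𝒪[v.adicCompletion K], (adeleAddChar K).adicComponent v (a * c) = 1) ∧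
      ∀ ϖ : v.adicCompletion K, Valued.v ϖ = WithZero.exp (-1 : ℤ) →
        ∃ c ∈ 𝒪[v.adicCompletion K], (adeleAddChar K).adicComponent v (a * (ϖ⁻¹ * c)) ≠ 1 := by
    intro v hv
    obtain ⟨d, a, hd, hratio, hψ⟩ := hoff v hv
    refine ⟨fun i => d (Fin.castLE hmn.le i), a, ?_, fun i j hij =>
      hratio (Fin.castLE hmn.le i) (Fin.castLE hmn.le j) (by simpa only [Fin.val_castLE] using hij), hψ⟩
    rw [localComponent_glDiagonal, ← glDiagonal_eq_diagonalGL] at hd ⊢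
    have hinj := glDiagonal_injective n hd
    congr 1
    funext i
    exact congrFun hinj (Fin.castLE hmn.le i)
  refine ⟨τ, T, fun i => rfl, hDinf, hoff, hoff', ?_⟩
  -- (2) the archimedean components of `π` and `σ`
  obtain ⟨E, _, _, _, τP, hτPi, hτPu, hτPc, hexP, -⟩ := exists_archComponent_decomposition (hcpt := hcpt) P
  obtain ⟨E', _, _, _, τQ, hτQi, hτQu, hτQc, hexQ, -⟩ := exists_archComponent_decomposition (hcpt := hcpt') Q
  -- (3) initial pure tensors of levels supported on `S₀`, with non-zero translated transferred functionals
  obtain ⟨𝔫P, h𝔫P, hsuppP, S₁, hS₁, w, hw⟩ :=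
    InitialVectorTranslateNeZero.stub_initialVector_translate_ne_zero hcpt (hm.trans hmn) P
      hτPu hτPi hτPc hexP ν₀ S₀ (fun v hv => (hunr v hv).1) T hDS₀ hoff
  obtain ⟨𝔫Q, h𝔫Q, hsuppQ, S₁', hS₁', w', hw'⟩ :=
    InitialVectorTranslateNeZero.stub_initialVector_translate_ne_zero hcpt' hm Q
      hτQu hτQi hτQc hexQ ν₀' S₀ (fun v hv => (hunr v hv).2) τ hD'S₀ hoff'
  -- (4) the archimedean Whittaker functionals `Φ_λ(D_f S₁)` and `Φ_λ'(D'_f S₁')`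
  have hlamP := isContWhittakerFunctional_whittakerFunctional ν₀ (continuous_adeleAddChar K)
    (isGlobalAddChar_adeleAddChar K) (ContRepresentation.Equiv.refl P.1.toContRep)
  have hlamQ := isContWhittakerFunctional_whittakerFunctional ν₀' (continuous_adeleAddChar K)
    (isGlobalAddChar_adeleAddChar K) (ContRepresentation.Equiv.refl Q.1.toContRep)
  have hℓ : IsArchContWhittakerFunctional hcpt τP hτPc
      (transferMap (whittakerFunctional ν₀ (continuous_adeleAddChar K) (ContRepresentation.Equiv.refl P.1.toContRep))
        hτPc (finComponentRep hcpt τP P.1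
          (GLn.sndHom n K (glDiagonal n (AdeleRing (𝓞 K) K) T)) S₁)) :=
    transferMap_mem_archContWhittakerFunctionals hlamP hτPc _
  have hℓ' : IsArchContWhittakerFunctional hcpt' τQ hτQc
      (transferMap (whittakerFunctional ν₀' (continuous_adeleAddChar K) (ContRepresentation.Equiv.refl Q.1.toContRep))
        hτQc (finComponentRep hcpt' τQ Q.1 (GLn.sndHom m K (glDiagonal m (AdeleRing (𝓞 K) K) τ)) S₁')) :=
    transferMap_mem_archContWhittakerFunctionals hlamQ hτQc _
  have hℓ0 : transferMap (whittakerFunctional ν₀ (continuous_adeleAddChar K) (ContRepresentation.Equiv.refl P.1.toContRep))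
      hτPc (finComponentRep hcpt τP P.1
        (GLn.sndHom n K (glDiagonal n (AdeleRing (𝓞 K) K) T)) S₁) ≠ 0 :=
    fun h => hw (by rw [h, LinearMap.zero_apply])
  have hℓ'0 : transferMap (whittakerFunctional ν₀' (continuous_adeleAddChar K) (ContRepresentation.Equiv.refl Q.1.toContRep))
      hτQc (finComponentRep hcpt' τQ Q.1 (GLn.sndHom m K (glDiagonal m (AdeleRing (𝓞 K) K) τ)) S₁') ≠ 0 :=
    fun h => hw' (by rw [h, LinearMap.zero_apply])
  -- (5) Borel structures on `GL_m(K_∞)`, and the image Haar measures on `(K_∞ˣ)ᵐ` and `K_∞`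
  letI : MeasurableSpace (GL (Fin m) (mixedSpace K)) := borel _
  haveI : BorelSpace (GL (Fin m) (mixedSpace K)) := ⟨rfl⟩
  haveI := locallyCompactSpace_ideleGroup K
  have hμA := isHaarMeasure_map_archTorusOfIdele (n := m) νA
  have hμK := isHaarMeasure_map_kinfOfMaximalCompact (n := m) νK
  -- (6) the archimedean data at `s₀` from (G-AFD) on the fact
  obtain ⟨k, e, e', hefin, he'fin, Λ, h, x₀, hΛ, hh, hh0, hsum⟩ :=
    hAFD (hJ n m K) hmn hcpt hcpt' E τP hτPc hτPu hτPi _ hℓ hℓ0 E' τQ hτQc hτQu hτQi _ hℓ' hℓ'0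
      ((νA.restrict (unitBox (Set.univ : Set (HeightOneSpectrum (𝓞 K))))).map (archTorusOfIdele m K)) hμA
      (νK.map (kinfOfMaximalCompact m K)) hμK s₀
  -- (7) the realisation of every datum in the translated gap box integral, by (G-LSD)
  have hsupp : ∀ w ∉ S₀, ¬ w.asIdeal ∣ 𝔫P * 𝔫Q := fun w hw h => hw <| by
    rcases w.prime.dvd_or_dvd h with h | h
    · exact hsuppP w h
    · exact hsuppQ w h
  have hM1 := fun i : Fin k =>
    hLSD hm hmn hcpt hcpt' P Q νA νK ν₀ ν₀' hτPc hτQc S₀ τ T hD'inf hD'S₀ hDinf hDS₀ h𝔫P h𝔫Q hsupp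
      S₁ hS₁ S₁' hS₁' (e i) (e' i) (hefin i) (he'fin i)
  choose 𝔫 h𝔫 hsupp𝔫 Φ Φ' sv sv' hΦc hΦ'c hae hae' hcusp hcusp' hinv hinv' κ hκ hbox using hM1
  -- (8) the data: `c_i := κ_i⁻¹`, `𝔫₀ := ∏ 𝔫_i`, `x₁ := x₀`
  have h𝔫₀ : ∏ i, 𝔫 i ≠ 0 := Finset.prod_ne_zero_iff.2 fun i _ => h𝔫 i
  have h𝔫₀le : ∀ i, ∏ j, 𝔫 j ≤ 𝔫 i := fun i => Ideal.prod_le_inf.trans (Finset.inf_le (Finset.mem_univ i))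
  refine ⟨k, fun i => (((κ i : ℝ) : ℂ))⁻¹, Φ, Φ', sv, sv', ∏ i, 𝔫 i, h𝔫₀, ?_, hΦc, hΦ'c, hae, hae', hcusp, hcusp',
    fun i u hu y => hinv i u (principalCongruenceLevel_mono n K h𝔫₀ (h𝔫₀le i) hu) y,
    fun i u hu y => hinv' i u (principalCongruenceLevel_mono m K h𝔫₀ (h𝔫₀le i) hu) y, Λ, h, x₀, hΛ, hh, hh0, ?_⟩
  · -- `𝔫₀` is supported on `S₀`
    intro w hw
    obtain ⟨i, hi⟩ := LocalPairTranslate.exists_dvd_of_dvd_prod 𝔫 hw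
    by_contra hwS
    exact hsupp𝔫 i w hwS hi
  · -- `Λ(s) Σ_i κ_i⁻¹ (κ_i Ψ^{(n,m)}_∞(s; e_i, e'_i)) = Λ(s) Σ_i Ψ^{(n,m)}_∞(s; e_i, e'_i) = h(s)`
    intro s hs
    rw [← hsum s hs]
    congr 1
    refine Finset.sum_congr rfl fun i _ => ?_
    rw [hbox i s, ← mul_assoc, inv_mul_cancel₀ (Complex.ofReal_ne_zero.2 (hκ i).ne'), one_mul]

/-! ### The registered stub -/

/-- **Registered stub `stub_gap_local_control` (G-LC) of the crux skeleton `PairLBoundaryJS`, line `Sketch`: the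
gap LOCAL Rankin–Selberg theory in translate form at a prescribed point `s₀`, granted the archimedean gap fact of
Jacquet (2009) / Jacquet–Shalika (1990)**, from `gap_local_control_of_parts`,
`GapArchFactorData.stub_gap_arch_factor_data` (G-AFD) and G-LSD in the landed form
`GapLocalSingleDatum.gap_local_single_datum_of_productForm GapUnitBoxProductForm.stub_gap_unitBox_productForm`
(the single datum granted the gap product form, applied to the landed gap product form).
[cite: CogdellAnalyticTheory2004, §3.2, §4.1 and §4.2]
[cite: JacquetArchimedeanRS2009, Thm. 2.6 (i) (p. 9)] -/
theorem stub_gap_local_control :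
    (∀ (N M : ℕ) (K : Type) [Field K] [NumberField K], JacquetShalika1990_archRankinSelbergGap_entireRatio N M K) →
    ∀ {n m : ℕ} {K : Type} [Field K] [NumberField K]
      {μ : Measure (AdelicGroupData.gl n K).automorphicQuotient}
      [(AdelicGroupData.gl n K).IsAutomorphicMeasure μ]
      {μ' : Measure (AdelicGroupData.gl m K).automorphicQuotient} [(AdelicGroupData.gl m K).IsAutomorphicMeasure μ']
      [MeasurableSpace (AdeleRing (𝓞 K) K)] [BorelSpace (AdeleRing (𝓞 K) K)] (_hm : 0 < m) (hmn : m < n)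
      (νA : Measure (Fin m → ideleGroup K)) [IsHaarMeasure νA]
      (νK : Measure ↥(maximalCompactAdelic m K)) [IsHaarMeasure νK]
      (ν₀ : Measure ↥(adelicUnipotent n K)) [IsHaarMeasure ν₀]
      (ν₀' : Measure ↥(adelicUnipotent m K)) [IsHaarMeasure ν₀']
      (P : CuspidalAutomorphicRepGL n K μ) (Q : CuspidalAutomorphicRepGL m K μ')
      (S₀ : Finset (HeightOneSpectrum (𝓞 K))), (∀ v ∉ S₀, IsUnramifiedAt P.1 v ∧ IsUnramifiedAt Q.1 v) →
      ∀ (s₀ : ℂ),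
      ∃ (τ : Fin m → ideleGroup K) (T : Fin n → ideleGroup K),
      (∀ i : Fin m, T (Fin.castLE hmn.le i) = τ i) ∧
      GLn.toMixed n K (glDiagonal n (AdeleRing (𝓞 K) K) T) = 1 ∧
      (∀ v ∉ S₀, ∃ (d : Fin n → (v.adicCompletion K)ˣ) (a : (v.adicCompletion K)ˣ),
        localComponent v (glDiagonal n (AdeleRing (𝓞 K) K) T) =
          diagonalGL (Fin n) (v.adicCompletion K) d ∧
        (∀ i j : Fin n, (i : ℕ) + 1 = j →
          (d i : v.adicCompletion K) * ((d j)⁻¹ : (v.adicCompletion K)ˣ) = a) ∧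
        (∀ c ∈ 𝒪[v.adicCompletion K], (adeleAddChar K).adicComponent v (a * c) = 1) ∧
        ∀ ϖ : v.adicCompletion K, Valued.v ϖ = WithZero.exp (-1 : ℤ) →
          ∃ c ∈ 𝒪[v.adicCompletion K], (adeleAddChar K).adicComponent v (a * (ϖ⁻¹ * c)) ≠ 1) ∧
      (∀ v ∉ S₀, ∃ (d : Fin m → (v.adicCompletion K)ˣ) (a : (v.adicCompletion K)ˣ),
        localComponent v (glDiagonal m (AdeleRing (𝓞 K) K) τ) =
          diagonalGL (Fin m) (v.adicCompletion K) d ∧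
        (∀ i j : Fin m, (i : ℕ) + 1 = j →
          (d i : v.adicCompletion K) * ((d j)⁻¹ : (v.adicCompletion K)ˣ) = a) ∧
        (∀ c ∈ 𝒪[v.adicCompletion K], (adeleAddChar K).adicComponent v (a * c) = 1) ∧
        ∀ ϖ : v.adicCompletion K, Valued.v ϖ = WithZero.exp (-1 : ℤ) →
          ∃ c ∈ 𝒪[v.adicCompletion K], (adeleAddChar K).adicComponent v (a * (ϖ⁻¹ * c)) ≠ 1) ∧
      ∃ (k : ℕ) (c : Fin k → ℂ)
        (Φ : Fin k → (AdelicGroupData.gl n K).automorphicQuotient → ℂ)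
        (Φ' : Fin k → (AdelicGroupData.gl m K).automorphicQuotient → ℂ)
        (sv : Fin k → P.1.toSubmodule) (sv' : Fin k → Q.1.toSubmodule) (𝔫₀ : Ideal (𝓞 K)),
      𝔫₀ ≠ 0 ∧ (∀ w : HeightOneSpectrum (𝓞 K), w.asIdeal ∣ 𝔫₀ → w ∈ S₀) ∧
      (∀ i, Continuous (Φ i)) ∧ (∀ i, Continuous (Φ' i)) ∧
      (∀ i, (((sv i : (AdelicGroupData.gl n K).L2 μ) : (AdelicGroupData.gl n K).automorphicQuotient → ℂ)
        =ᵐ[μ] Φ i)) ∧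
      (∀ i, (((sv' i : (AdelicGroupData.gl m K).L2 μ') : (AdelicGroupData.gl m K).automorphicQuotient → ℂ)
        =ᵐ[μ'] Φ' i)) ∧
      (∀ i, IsCuspFormGL n K (isCompact_glFiniteIntegralLevel_holds n K)
        (invQuot (AdelicGroupData.gl n K) (Φ i))) ∧
      (∀ i, IsCuspFormGL m K (isCompact_glFiniteIntegralLevel_holds m K) (invQuot (AdelicGroupData.gl m K) (Φ' i))) ∧
      (∀ i, ∀ u ∈ principalCongruenceLevel n K 𝔫₀, ∀ y : GL (Fin n) (AdeleRing (𝓞 K) K),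
        invQuot (AdelicGroupData.gl n K) (Φ i) (y * u) = invQuot (AdelicGroupData.gl n K) (Φ i) y) ∧
      (∀ i, ∀ u ∈ principalCongruenceLevel m K 𝔫₀, ∀ y : GL (Fin m) (AdeleRing (𝓞 K) K),
        invQuot (AdelicGroupData.gl m K) (Φ' i) (y * u) = invQuot (AdelicGroupData.gl m K) (Φ' i) y) ∧
      ∃ (Λ h : ℂ → ℂ) (x₁ : ℝ), Differentiable ℂ Λ ∧ Differentiable ℂ h ∧ h s₀ ≠ 0 ∧ ∀ s : ℂ, x₁ < s.re →
        Λ s * ∑ i, c i * ∫ p in unitBox {v | v ∉ (↑S₀ : Set (HeightOneSpectrum (𝓞 K)))} ×ˢ Set.univ,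
          torusPairIntegrandC m K
            (fun g => whittakerCoeff ν₀ (unipotentTateDomain n K) (adeleAddChar K)
              (invQuot (AdelicGroupData.gl n K) (Φ i))
              (glDiagonal n (AdeleRing (𝓞 K) K) T * glCorner (AdeleRing (𝓞 K) K) hmn.le g))
            (fun g => star (whittakerCoeff ν₀' (unipotentTateDomain m K) (adeleAddChar K)
              (invQuot (AdelicGroupData.gl m K) (Φ' i)) (glDiagonal m (AdeleRing (𝓞 K) K) τ * g)))
            (fun _ => (1 : ℝ)) s p ∂(νA.prod νK) = h s :=
  fun hJ => gap_local_control_of_parts GapArchFactorData.stub_gap_arch_factor_data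
    (GapLocalSingleDatum.gap_local_single_datum_of_productForm GapUnitBoxProductForm.stub_gap_unitBox_productForm) hJ

end Summit.Langlands.Langlands.Theorems.GapLocalControlAsm

end
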